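import Literature.NumberTheory.LFunctions.VinogradovZetaSumLemmas
import Literature.NumberTheory.LFunctions.VinogradovMeanValueStepA
import HarnessLib

/-!
# Korobov's bound for the bilinear Weyl sums `∑_x ∑_y e(α₁xy + ⋯ + α_r x^r y^r)` in terms of
# Vinogradov's mean value (Ivić, proof of Theorem 6.2, pp. 145–146)

Topic `Literature/NumberTheory/LFunctions`.  Everything in this file is PROVED; no named fact (the `def`s
are the explicit finite sums being estimated).  It is the combinatorial heart of the proof of Theorem 6.2 of
A. Ivić, *The Riemann Zeta-Function* (1985) — Korobov's deduction of the zeta-sum estimate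
`∑_{N<n≤N'} n^{it} ≪ N exp(−c log³N/log²t)` from Vinogradov's mean value theorem — built on the tree's
`VMV.J`, `VMV.tp`, `VMV.tp_tuples_psv` (`VinogradovMeanValueCount/Torus/StepA.lean`) and on Ivić's
Lemma 6.4 in the form `VinogradovZetaSum.norm_sum_e_mul_le_geomBound` (`VinogradovZetaSumLemmas.lean`).
What remains of Ivić's proof after this file is analytic bookkeeping: the shift `n ↦ n + xy` and the
Taylor expansion reducing the zeta sum to `U` ((6.36)–(6.40)), Lemma 6.5 for the factors with
`2Y < m ≤ 5Y` (`VinogradovZetaSum.sum_geomBound_linear_Icc_le`), Lemma 6.3 for `J_{k,r}(a)`, and the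
choice `r = [5.01 log t/log N]`, `k = 5r²` (pp. 146–147).

For integers `r, k, a ≥ 1` and real `α = (α₁, …, α_r)` put
`U = ∑_{x ≤ a} ∑_{y ≤ a} e(α₁ xy + α₂ x²y² + ⋯ + α_r x^r y^r)` (`VKZeta.Usum`).  Then
(`norm_Usum_pow_le`, Ivić p. 146, the display before "where `A_m = 2ka^m`"):

  `|U|^{4k²} ≤ J_{k,r}(a)² · a^{8k² − 4k} · ∏_{j=1}^{r} ∑_{|μ| < A_j} min(2A_j, 1/(2‖α_j μ‖))`,
  `A_j = k a^j` (`min` read as `2A_j` at integers: the tree's `Sieve.Vinogradov.geomBound`),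

where `J_{k,r}(a) = Literature.NumberTheory.LFunctions.VMV.J r k [1, a]` is Vinogradov's mean value
(the number of solutions of `∑_{i≤k} (x_i^j − y_i^j) = 0`, `1 ≤ j ≤ r`, `x_i, y_i ∈ [1, a]`;
`VinogradovMeanValueCount.lean`) and `‖·‖` is the distance to the nearest integer.  (Ivić has
`A_m = 2ka^m`; any `A_j > k(a^j − 1)` works, the sums being over `|μ| ≤ A_j − 1`.)

Proof (Ivić pp. 145–146, with sums over pairs of tuples in place of sums over `λ` weighted by
`J_{k,r}(λ)`): Hölder in `x`; `|∑_y e(…)|^{2k} = ∑_{(Y,Y')} e(α^{(x)}·(s(Y) − s(Y')))` with the dilated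
point `α^{(x)}_j = α_j x^j` (`VMV.tp_tuples_psv`); interchange, so that the `x`-sum becomes the Weyl sum
`G(λ) = ∑_x e(∑_j α_j λ_j x^j)`, `λ = s(Y) − s(Y')`; Hölder over the `a^{2k}` pairs; `∑_{pairs} F(λ) =
∑_λ J_{k,r}(λ)F(λ) ≤ J_{k,r}(a) ∑_{λ ∈ box} F(λ)` (Ivić (6.10)–(6.11), `VMV.Jc_le_J`); expand `|G(λ)|^{2k}`
the same way and sum over the box `|λ_j| < A_j` first, where `∑_{λ_j} e(α_j μ_j λ_j)` is a linear sum
`≤ min(2A_j, 1/(2‖α_j μ_j‖))` (Lemma 6.4, `VKZeta.norm_sum_Icc_e_le_mn`); finally (6.10)–(6.11) once more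
and `∑_{μ ∈ box} ∏_j = ∏_j ∑_{μ_j}`.

## References

* A. Ivić, *The Riemann Zeta-Function*, John Wiley & Sons 1985 (Dover 2003), §6.2 (6.10), (6.11), (6.14),
  (6.15) and §6.3, proof of Theorem 6.2, pp. 145–146. [Ivic1985]
* N. M. Korobov, *Exponential Sums and their Applications*, Kluwer 1992, Ch. II (the method). [Korobov1992]
-/

noncomputable section

open Finset Real Complex
open scoped ComplexConjugate

namespace Literature.NumberTheory.LFunctions
namespace VKZeta

open VMV VinogradovZetaSum Literature.NumberTheory.Sieve.Vinogradov

variable {r : ℕ}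

/-! ### Dilations and coordinatewise products of frequency vectors -/

/-- `(α ⊙ λ)_j = α_j λ_j`. [folklore] -/
def hmul (α : Fin r → ℝ) (lam : Fin r → ℤ) : Fin r → ℝ := fun j => α j * lam j

/-- The dilated point `α^{(x)} = (α_j x^j)_j` (index `j : Fin r` stands for the exponent `j+1`).
[cite: Ivic1985, (6.15)] -/
def dil (x : ℤ) (α : Fin r → ℝ) : Fin r → ℝ := fun j => (x : ℝ) ^ (j.val + 1) * α j

/-- `e(α·ν(xy)) = e(α^{(x)}·ν(y))`. [cite: Ivic1985, (6.15)] -/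
theorem E_nu_mul (x y : ℤ) (α : Fin r → ℝ) : E (nu r (x * y)) α = E (nu r y) (dil x α) := by
  unfold E nu dil
  refine prod_congr rfl fun j _ => ?_
  congr 1; push_cast; ring

/-- `e(λ·α^{(x)}) = e((α ⊙ λ)·ν(x))`. [cite: Ivic1985, (6.15)] -/
theorem E_dil (lam : Fin r → ℤ) (x : ℤ) (α : Fin r → ℝ) :
    E lam (dil x α) = E (nu r x) (hmul α lam) := by
  unfold E nu dil hmul
  refine prod_congr rfl fun j _ => ?_
  congr 1; push_cast; ring

/-- `e(μ·(α ⊙ λ)) = ∏_j e((α_j μ_j) λ_j)`. [folklore] -/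
theorem E_hmul (mu lam : Fin r → ℤ) (α : Fin r → ℝ) :
    E mu (hmul α lam) = ∏ j, VdC.e ((α j * mu j) * lam j) := by
  unfold E hmul
  refine prod_congr rfl fun j _ => ?_
  congr 1; ring

/-! ### `|f|²` and `|f|^{2k}` as sums over pairs (Ivić (6.14)) -/

/-- `|∑_{i∈s} e(α·v_i)|² = ∑_{(i,i')} e(α·(v_i − v_{i'}))`. [cite: Ivic1985, (6.14)] -/
theorem normSq_tp {ι : Type*} (s : Finset ι) (v : ι → Fin r → ℤ) (β : Fin r → ℝ) :
    ((‖tp s v β‖ : ℂ)) ^ 2 = ∑ p ∈ s ×ˢ s, E (v p.1 - v p.2) β := by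
  rw [← Complex.mul_conj', conj_tp, tp_mul]
  unfold tp
  refine sum_congr rfl fun p _ => ?_
  rw [sub_eq_add_neg]

/-- `|∑_{y∈I} e(β·ν(y))|^{2k} = ∑_{(Y,Y') ∈ I^k × I^k} e(β·(s(Y) − s(Y')))`. [cite: Ivic1985, (6.14)] -/
theorem norm_tp_nu_pow (k : ℕ) (I : Finset ℤ) (β : Fin r → ℝ) :
    ((‖tp I (nu r) β‖ : ℂ)) ^ (2 * k) =
      ∑ p ∈ tuples k I ×ˢ tuples k I, E (psv r p.1 - psv r p.2) β := by
  rw [mul_comm 2 k, pow_mul, ← Complex.ofReal_pow, ← norm_pow, ← tp_tuples_psv]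
  exact normSq_tp _ _ _

/-! ### Sums over pairs against `J_{k,r}(λ)` (Ivić (6.10)–(6.11)) -/

/-- `∑_{(Y,Y')} F(s(Y) − s(Y')) = ∑_λ J_{k,r}(I; λ) F(λ)`. [cite: Ivic1985, (6.11) and (6.14)] -/
theorem sum_pairs_eq_sum_Jc (k : ℕ) (I : Finset ℤ) (F : (Fin r → ℤ) → ℝ) {Λ : Finset (Fin r → ℤ)}
    (hΛ : ∀ p ∈ tuples k I ×ˢ tuples k I, psv r p.1 - psv r p.2 ∈ Λ) :
    ∑ p ∈ tuples k I ×ˢ tuples k I, F (psv r p.1 - psv r p.2) =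
      ∑ lam ∈ Λ, (Jc r k I lam : ℝ) * F lam := by
  rw [← sum_fiberwise_of_maps_to hΛ]
  refine sum_congr rfl fun lam _ => ?_
  have : ∀ p ∈ (tuples k I ×ˢ tuples k I).filter (fun p => psv r p.1 - psv r p.2 = lam),
      F (psv r p.1 - psv r p.2) = F lam := by
    intro p hp
    rw [(mem_filter.1 hp).2]
  rw [sum_congr rfl this, sum_const, nsmul_eq_mul]
  congr 2
  unfold Jc
  congr 1
  refine filter_congr fun p _ => ?_
  constructor
  · intro h; rw [← h]; abel
  · intro h; rw [h]; abel

/-- **`∑_{(Y,Y')} F(s(Y) − s(Y')) ≤ J_{k,r}(I) ∑_{λ ∈ Λ} F(λ)`** for `F ≥ 0` and any `Λ` containing the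
differences `s(Y) − s(Y')`. [cite: Ivic1985, (6.10)–(6.11)] -/
theorem sum_pairs_le_J_mul (k : ℕ) (I : Finset ℤ) (F : (Fin r → ℤ) → ℝ) {Λ : Finset (Fin r → ℤ)}
    (hΛ : ∀ p ∈ tuples k I ×ˢ tuples k I, psv r p.1 - psv r p.2 ∈ Λ) (hF : ∀ lam ∈ Λ, 0 ≤ F lam) :
    ∑ p ∈ tuples k I ×ˢ tuples k I, F (psv r p.1 - psv r p.2) ≤ (J r k I : ℝ) * ∑ lam ∈ Λ, F lam := by
  rw [sum_pairs_eq_sum_Jc k I F hΛ, mul_sum]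
  refine sum_le_sum fun lam hlam => ?_
  refine mul_le_mul_of_nonneg_right ?_ (hF lam hlam)
  exact_mod_cast Jc_le_J r k I lam

/-! ### The box of differences -/

/-- `A_j = k a^j` (index `j : Fin r` for the exponent `j+1`). [cite: Ivic1985, p. 146] -/
def Abnd (k a : ℕ) (j : Fin r) : ℕ := k * a ^ (j.val + 1)

/-- The box `∏_j [−(A_j − 1), A_j − 1] ⊂ ℤ^r`. [cite: Ivic1985, p. 146] -/
def Lbox (r k a : ℕ) : Finset (Fin r → ℤ) :=
  Fintype.piFinset fun j : Fin r => Icc (-((Abnd k a j - 1 : ℕ) : ℤ)) ((Abnd k a j - 1 : ℕ) : ℤ)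

/-- Power sums of tuples from `[1,a]^k` lie in `[k, k a^j]`. [folklore] -/
theorem psv_mem_Icc {k a : ℕ} {Y : Fin k → ℤ} (hY : Y ∈ tuples k (Icc (1 : ℤ) a)) (j : Fin r) :
    (k : ℤ) ≤ psv r Y j ∧ psv r Y j ≤ (k : ℤ) * (a : ℤ) ^ (j.val + 1) := by
  unfold psv
  have hYi : ∀ i, 1 ≤ Y i ∧ Y i ≤ a := fun i => mem_Icc.1 (mem_tuples.1 hY i)
  constructor
  · have : ∑ _i : Fin k, (1 : ℤ) ≤ ∑ i, Y i ^ (j.val + 1) :=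
      sum_le_sum fun i _ => one_le_pow₀ (hYi i).1
    simpa using this
  · have : ∑ i, Y i ^ (j.val + 1) ≤ ∑ _i : Fin k, (a : ℤ) ^ (j.val + 1) :=
      sum_le_sum fun i _ => pow_le_pow_left₀ (by linarith [(hYi i).1]) (hYi i).2 _
    simpa using this

/-- The differences `s(Y) − s(Y')`, `Y, Y' ∈ [1,a]^k`, lie in the box (`k ≥ 1`). [cite: Ivic1985, (6.12)] -/
theorem psv_sub_mem_Lbox {k a : ℕ} (hk : 1 ≤ k)
    {p : (Fin k → ℤ) × (Fin k → ℤ)} (hp : p ∈ tuples k (Icc (1 : ℤ) a) ×ˢ tuples k (Icc (1 : ℤ) a)) :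
    psv r p.1 - psv r p.2 ∈ Lbox r k a := by
  rw [Lbox, Fintype.mem_piFinset]
  intro j
  have h1 := psv_mem_Icc (r := r) (mem_product.1 hp).1 j
  have h2 := psv_mem_Icc (r := r) (mem_product.1 hp).2 j
  have hA : ((Abnd k a j - 1 : ℕ) : ℤ) = (k : ℤ) * (a : ℤ) ^ (j.val + 1) - 1 := by
    have : 1 ≤ Abnd k a j := by
      unfold Abnd
      rcases Nat.eq_zero_or_pos a with rfl | ha
      · -- a = 0: then tuples is empty unless k = 0; but k ≥ 1 so hp impossible; still need the arithmetic
        exfalso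
        have := (mem_product.1 hp).1
        rw [mem_tuples] at this
        have := mem_Icc.1 (this ⟨0, hk⟩)
        push_cast at this
        omega
      · exact Nat.one_le_iff_ne_zero.2 (Nat.mul_ne_zero (Nat.one_le_iff_ne_zero.1 hk) (pow_ne_zero _ ha.ne'))
    rw [Nat.cast_sub this]
    simp [Abnd]
  rw [mem_Icc, hA, Pi.sub_apply]
  have hk' : (1 : ℤ) ≤ k := by exact_mod_cast hk
  constructor <;> linarith [h1.1, h1.2, h2.1, h2.2]

/-! ### The bilinear sum and Korobov's bound -/

/-- `U = ∑_{x≤a} ∑_{y≤a} e(α₁xy + ⋯ + α_r x^r y^r)`. [cite: Ivic1985, (6.40)] -/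
def Usum (a : ℕ) (α : Fin r → ℝ) : ℂ :=
  ∑ x ∈ Icc (1 : ℤ) a, ∑ y ∈ Icc (1 : ℤ) a, E (nu r (x * y)) α

/-- The Weyl sum `G(λ) = ∑_{x ≤ a} e(∑_j α_j λ_j x^j)`. [cite: Ivic1985, p. 145] -/
def Gsum (a : ℕ) (α : Fin r → ℝ) (lam : Fin r → ℤ) : ℂ := tp (Icc (1 : ℤ) a) (nu r) (hmul α lam)

/-- The factor `∑_{|μ| < A_j} min(2A_j, 1/(2‖α_j μ‖))`. [cite: Ivic1985, p. 146] -/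
def mnSum (k a : ℕ) (α : Fin r → ℝ) (j : Fin r) : ℝ :=
  ∑ μ ∈ Icc (-((Abnd k a j - 1 : ℕ) : ℤ)) ((Abnd k a j - 1 : ℕ) : ℤ), geomBound (2 * (Abnd k a j : ℝ)) (α j * μ)

/-- The factors are nonnegative. [folklore] -/
theorem mnSum_nonneg (k a : ℕ) (α : Fin r → ℝ) (j : Fin r) : 0 ≤ mnSum k a α j :=
  sum_nonneg fun μ _ => geomBound_nonneg (by positivity) _

/-- `#[1, a] = a` in `ℤ`. [folklore] -/
theorem card_Icc_one (a : ℕ) : ((Icc (1 : ℤ) a).card : ℝ) = a := by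
  rw [Int.card_Icc]; simp

/-- `#[−M, M] = 2M + 1` in `ℤ`. [folklore] -/
theorem card_Icc_neg (M : ℕ) : ((Icc (-(M : ℤ)) (M : ℤ)).card : ℝ) = 2 * M + 1 := by
  rw [Int.card_Icc]
  have : ((M : ℤ) + 1 - -(M : ℤ)) = ((2 * M + 1 : ℕ) : ℤ) := by push_cast; ring
  rw [this, Int.toNat_natCast]; push_cast; ring

/-- Finite Hölder: `(∑_{i∈s} f_i)^{2k} ≤ |s|^{2k−1} ∑ f_i^{2k}` for `f ≥ 0`, `k ≥ 1`. [folklore] -/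
theorem pow_sum_le {ι : Type*} (s : Finset ι) {f : ι → ℝ} (hf : ∀ i ∈ s, 0 ≤ f i) {k : ℕ} (hk : 1 ≤ k) :
    (∑ i ∈ s, f i) ^ (2 * k) ≤ (s.card : ℝ) ^ (2 * k - 1) * ∑ i ∈ s, f i ^ (2 * k) := by
  rcases s.eq_empty_or_nonempty with rfl | hs
  · simp only [sum_empty, card_empty, Nat.cast_zero, mul_zero]
    rw [zero_pow (by omega)]
  have hcard : (0 : ℝ) < s.card := by exact_mod_cast hs.card_pos
  have h := pow_sum_div_card_le_sum_pow (s := s) (f := f) hf (2 * k - 1)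
  have e : 2 * k - 1 + 1 = 2 * k := by omega
  rw [e, div_le_iff₀ (by positivity)] at h
  calc (∑ i ∈ s, f i) ^ (2 * k) ≤ (∑ i ∈ s, f i ^ (2 * k)) * (s.card : ℝ) ^ (2 * k - 1) := h
    _ = _ := mul_comm _ _

/-- Step 1 (Hölder in `x`): `|U|^{2k} ≤ a^{2k−1} ∑_x |∑_y e(α^{(x)}·ν(y))|^{2k}`. [cite: Ivic1985, p. 145] -/
theorem norm_Usum_pow_le_step1 (a : ℕ) (α : Fin r → ℝ) {k : ℕ} (hk : 1 ≤ k) :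
    ‖Usum a α‖ ^ (2 * k) ≤
      (a : ℝ) ^ (2 * k - 1) * ∑ x ∈ Icc (1 : ℤ) a, ‖tp (Icc (1 : ℤ) a) (nu r) (dil x α)‖ ^ (2 * k) := by
  have h1 : ‖Usum a α‖ ≤ ∑ x ∈ Icc (1 : ℤ) a, ‖tp (Icc (1 : ℤ) a) (nu r) (dil x α)‖ := by
    unfold Usum
    refine (norm_sum_le _ _).trans (le_of_eq ?_)
    refine sum_congr rfl fun x _ => ?_
    unfold tp
    congr 1
    exact sum_congr rfl fun y _ => E_nu_mul x y α
  calc ‖Usum a α‖ ^ (2 * k) ≤ (∑ x ∈ Icc (1 : ℤ) a, ‖tp (Icc (1 : ℤ) a) (nu r) (dil x α)‖) ^ (2 * k) :=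
        pow_le_pow_left₀ (norm_nonneg _) h1 _
    _ ≤ _ := by
        have := pow_sum_le (Icc (1 : ℤ) a) (f := fun x => ‖tp (Icc (1 : ℤ) a) (nu r) (dil x α)‖)
          (fun _ _ => norm_nonneg _) hk
        rwa [card_Icc_one] at this

/-- Step 2 (expand and interchange): `∑_x |∑_y e(α^{(x)}·ν(y))|^{2k} ≤ ∑_{(Y,Y')} |G(s(Y) − s(Y'))|`.
[cite: Ivic1985, (6.15)] -/
theorem sum_norm_tp_pow_le_sum_norm_Gsum (a k : ℕ) (α : Fin r → ℝ) :
    ∑ x ∈ Icc (1 : ℤ) a, ‖tp (Icc (1 : ℤ) a) (nu r) (dil x α)‖ ^ (2 * k) ≤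
      ∑ p ∈ tuples k (Icc (1 : ℤ) a) ×ˢ tuples k (Icc (1 : ℤ) a), ‖Gsum a α (psv r p.1 - psv r p.2)‖ := by
  have hC : ((∑ x ∈ Icc (1 : ℤ) a, ‖tp (Icc (1 : ℤ) a) (nu r) (dil x α)‖ ^ (2 * k) : ℝ) : ℂ) =
      ∑ p ∈ tuples k (Icc (1 : ℤ) a) ×ˢ tuples k (Icc (1 : ℤ) a), Gsum a α (psv r p.1 - psv r p.2) := by
    push_cast
    simp_rw [norm_tp_nu_pow]
    rw [sum_comm]
    refine sum_congr rfl fun p _ => ?_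
    unfold Gsum tp
    refine sum_congr rfl fun x _ => ?_
    exact E_dil _ x α
  have hre : (∑ x ∈ Icc (1 : ℤ) a, ‖tp (Icc (1 : ℤ) a) (nu r) (dil x α)‖ ^ (2 * k)) =
      (∑ p ∈ tuples k (Icc (1 : ℤ) a) ×ˢ tuples k (Icc (1 : ℤ) a), Gsum a α (psv r p.1 - psv r p.2)).re := by
    rw [← hC, Complex.ofReal_re]
  rw [hre, Complex.re_sum]
  exact sum_le_sum fun p _ => Complex.re_le_norm _

/-- Step 5 (expand `|G(λ)|^{2k}` and sum over the box first):
`∑_{λ ∈ box} |G(λ)|^{2k} ≤ ∑_{(X,X')} ∏_j min(2A_j, 1/(2‖α_j μ_j‖))`, `μ = s(X) − s(X')`.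
[cite: Ivic1985, p. 146] -/
theorem sum_norm_Gsum_pow_le {a k : ℕ} (ha : 1 ≤ a) (hk : 1 ≤ k) (α : Fin r → ℝ) :
    ∑ lam ∈ Lbox r k a, ‖Gsum a α lam‖ ^ (2 * k) ≤
      ∑ p ∈ tuples k (Icc (1 : ℤ) a) ×ˢ tuples k (Icc (1 : ℤ) a),
        ∏ j, geomBound (2 * (Abnd k a j : ℝ)) (α j * (psv r p.1 - psv r p.2) j) := by
  classical
  set T := tuples k (Icc (1 : ℤ) a) ×ˢ tuples k (Icc (1 : ℤ) a) with hT
  -- complex identity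
  have hC : ((∑ lam ∈ Lbox r k a, ‖Gsum a α lam‖ ^ (2 * k) : ℝ) : ℂ) =
      ∑ p ∈ T, ∏ j : Fin r, ∑ l ∈ Icc (-((Abnd k a j - 1 : ℕ) : ℤ)) ((Abnd k a j - 1 : ℕ) : ℤ),
        VdC.e ((α j * (psv r p.1 - psv r p.2) j) * l) := by
    push_cast
    unfold Gsum
    simp_rw [norm_tp_nu_pow]
    rw [sum_comm]
    refine sum_congr rfl fun p _ => ?_
    simp_rw [E_hmul]
    exact (Finset.prod_univ_sum (fun j : Fin r => Icc (-((Abnd k a j - 1 : ℕ) : ℤ)) ((Abnd k a j - 1 : ℕ) : ℤ))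
      (fun j (l : ℤ) => VdC.e ((α j * (psv r p.1 - psv r p.2) j) * l))).symm
  have hre : ∑ lam ∈ Lbox r k a, ‖Gsum a α lam‖ ^ (2 * k) =
      (∑ p ∈ T, ∏ j : Fin r, ∑ l ∈ Icc (-((Abnd k a j - 1 : ℕ) : ℤ)) ((Abnd k a j - 1 : ℕ) : ℤ),
        VdC.e ((α j * (psv r p.1 - psv r p.2) j) * l)).re := by
    rw [← hC, Complex.ofReal_re]
  rw [hre, Complex.re_sum]
  refine sum_le_sum fun p _ => ?_
  refine (Complex.re_le_norm _).trans ?_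
  rw [norm_prod]
  refine prod_le_prod (fun j _ => norm_nonneg _) fun j _ => ?_
  have h1 : 1 ≤ Abnd k a j :=
    Nat.one_le_iff_ne_zero.2 (Nat.mul_ne_zero (Nat.one_le_iff_ne_zero.1 hk)
      (pow_ne_zero _ (Nat.one_le_iff_ne_zero.1 ha)))
  set M : ℕ := Abnd k a j - 1 with hM
  have hI : Icc (-(M : ℤ)) (M : ℤ) = Ioc (-(M : ℤ) - 1) (-(M : ℤ) - 1 + ((2 * M + 1 : ℕ) : ℤ)) := by
    ext μ; simp only [mem_Ioc, mem_Icc]; push_cast; omega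
  rw [hI]
  refine (norm_sum_e_mul_le_geomBound _ _ _).trans (geomBound_mono ?_ _)
  have e : ((2 * M + 1 : ℕ) : ℝ) = 2 * (Abnd k a j : ℝ) - 1 := by
    rw [hM]; push_cast [Nat.cast_sub h1]; ring
  rw [e]; linarith

/-- **Korobov's bound for the bilinear Weyl sum** (Ivić, proof of Theorem 6.2, p. 146):
`|U|^{4k²} ≤ J_{k,r}(a)² a^{8k²−4k} ∏_{j≤r} ∑_{|μ|<A_j} min(2A_j, 1/(2‖α_jμ‖))`, `A_j = k a^j`.
[cite: Ivic1985, proof of Theorem 6.2, p. 146] -/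
theorem norm_Usum_pow_le {k a : ℕ} (ha : 1 ≤ a) (hk : 1 ≤ k) (α : Fin r → ℝ) :
    ‖Usum a α‖ ^ (4 * k ^ 2) ≤
      (J r k (Icc (1 : ℤ) a) : ℝ) ^ 2 * (a : ℝ) ^ (8 * k ^ 2 - 4 * k) * ∏ j, mnSum k a α j := by
  classical
  set I := Icc (1 : ℤ) a with hI
  set T := tuples k I ×ˢ tuples k I with hT
  have hJ0 : (0 : ℝ) ≤ J r k I := by positivity
  have ha0 : (0 : ℝ) ≤ a := by positivity
  -- the quantities
  set S1 := ∑ x ∈ I, ‖tp I (nu r) (dil x α)‖ ^ (2 * k) with hS1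
  set S2 := ∑ p ∈ T, ‖Gsum a α (psv r p.1 - psv r p.2)‖ with hS2
  set S3 := ∑ p ∈ T, ‖Gsum a α (psv r p.1 - psv r p.2)‖ ^ (2 * k) with hS3
  set S4 := ∑ lam ∈ Lbox r k a, ‖Gsum a α lam‖ ^ (2 * k) with hS4
  set S5 := ∑ p ∈ T, ∏ j, geomBound (2 * (Abnd k a j : ℝ)) (α j * (psv r p.1 - psv r p.2) j) with hS5
  have hS1n : 0 ≤ S1 := sum_nonneg fun _ _ => by positivity
  have hS2n : 0 ≤ S2 := sum_nonneg fun _ _ => norm_nonneg _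
  have h1 : ‖Usum a α‖ ^ (2 * k) ≤ (a : ℝ) ^ (2 * k - 1) * S1 := norm_Usum_pow_le_step1 a α hk
  have h2 : S1 ≤ S2 := sum_norm_tp_pow_le_sum_norm_Gsum a k α
  have hcardT : (T.card : ℝ) = (a : ℝ) ^ (2 * k) := by
    rw [hT, card_product, card_tuples, hI, Int.card_Icc]
    simp; ring
  have h3 : S2 ^ (2 * k) ≤ ((a : ℝ) ^ (2 * k)) ^ (2 * k - 1) * S3 := by
    have := pow_sum_le T (f := fun p => ‖Gsum a α (psv r p.1 - psv r p.2)‖) (fun _ _ => norm_nonneg _) hk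
    rwa [hcardT] at this
  have h4 : S3 ≤ (J r k I : ℝ) * S4 :=
    sum_pairs_le_J_mul k I (fun lam => ‖Gsum a α lam‖ ^ (2 * k))
      (fun p hp => psv_sub_mem_Lbox hk hp) (fun _ _ => by positivity)
  have h5 : S4 ≤ S5 := sum_norm_Gsum_pow_le ha hk α
  have h6 : S5 ≤ (J r k I : ℝ) * ∏ j, mnSum k a α j := by
    have := sum_pairs_le_J_mul k I (fun mu => ∏ j, geomBound (2 * (Abnd k a j : ℝ)) (α j * mu j))
      (fun p hp => psv_sub_mem_Lbox hk hp)
      (fun _ _ => prod_nonneg fun j _ => geomBound_nonneg (by positivity) _)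
    refine this.trans (le_of_eq ?_)
    congr 1
    unfold mnSum
    exact (Finset.prod_univ_sum (fun j : Fin r => Icc (-((Abnd k a j - 1 : ℕ) : ℤ)) ((Abnd k a j - 1 : ℕ) : ℤ))
      (fun j (m : ℤ) => geomBound (2 * (Abnd k a j : ℝ)) (α j * m))).symm
  -- assembly
  have hpow : 4 * k ^ 2 = 2 * k * (2 * k) := by ring
  have hexp : (2 * k - 1) * (2 * k) + 2 * k * (2 * k - 1) = 8 * k ^ 2 - 4 * k := by
    have : 1 ≤ k := hk
    zify [show 4 * k ≤ 8 * k ^ 2 by nlinarith, show 1 ≤ 2 * k by omega]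
    ring
  calc ‖Usum a α‖ ^ (4 * k ^ 2) = (‖Usum a α‖ ^ (2 * k)) ^ (2 * k) := by rw [hpow, pow_mul]
    _ ≤ ((a : ℝ) ^ (2 * k - 1) * S1) ^ (2 * k) := pow_le_pow_left₀ (by positivity) h1 _
    _ ≤ ((a : ℝ) ^ (2 * k - 1) * S2) ^ (2 * k) := by gcongr
    _ = ((a : ℝ) ^ (2 * k - 1)) ^ (2 * k) * S2 ^ (2 * k) := mul_pow _ _ _
    _ ≤ ((a : ℝ) ^ (2 * k - 1)) ^ (2 * k) * (((a : ℝ) ^ (2 * k)) ^ (2 * k - 1) * S3) := by gcongr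
    _ ≤ ((a : ℝ) ^ (2 * k - 1)) ^ (2 * k) * (((a : ℝ) ^ (2 * k)) ^ (2 * k - 1) * ((J r k I : ℝ) * S4)) := by
        gcongr
    _ ≤ ((a : ℝ) ^ (2 * k - 1)) ^ (2 * k) * (((a : ℝ) ^ (2 * k)) ^ (2 * k - 1) * ((J r k I : ℝ) * S5)) := by
        gcongr
    _ ≤ ((a : ℝ) ^ (2 * k - 1)) ^ (2 * k) *
          (((a : ℝ) ^ (2 * k)) ^ (2 * k - 1) * ((J r k I : ℝ) * ((J r k I : ℝ) * ∏ j, mnSum k a α j))) := by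
        gcongr
    _ = (J r k I : ℝ) ^ 2 * (a : ℝ) ^ (8 * k ^ 2 - 4 * k) * ∏ j, mnSum k a α j := by
        rw [← pow_mul, ← pow_mul, ← hexp, pow_add]; ring

end VKZeta
end Literature.NumberTheory.LFunctions
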